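import Literature.Geometry.GeometricMeasureTheory.RectifiableImagePieceData
import Literature.Geometry.GeometricMeasureTheory.CurrentsPushforward

/-!
# The induced map `⋀_m A` on `m`-vectors; frames pushed forward by linear maps

Fourth brick of `f_# 𝓡_m ⊆ 𝓡_m` (Federer 4.1.30): linear algebra of `m`-vectors under a
continuous linear map `A : V →L V'`.

* `Multivector.push A : Multivector V m →L Multivector V' m` — the map `⋀_m A` (the transpose of
  the pull-back `φ ↦ φ ∘ ⋀^m A` of `m`-covectors), with `push A (v₁ ∧ ⋯ ∧ vₘ) = A v₁ ∧ ⋯ ∧ A vₘ`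
  (`push_frameVector`), `‖push A w‖ ≤ ‖A‖ᵐ ‖w‖` (`norm_push_le`) and continuity in `A`
  (`continuous_push`);
* `frameVector_eq_sign_smul_of_span_eq_range` — an orthonormal frame `ξ` spanning `im L`
  (`L : P →L V` injective, `e` an orthonormal basis of `P`) has
  `ξ₁ ∧ ⋯ ∧ ξₘ = ± J(L)⁻¹ • (L e₁ ∧ ⋯ ∧ L eₘ)`;
* `apply_comp_eq_zero_of_not_injective` — `φ(L e₁, …, L eₘ) = 0` if `L` is not injective.

Definitions with bodies + theorems; no named facts.

## References

* H. Federer, *Geometric Measure Theory*, Springer 1969, 1.3–1.4, 1.7.6, 4.1.30 [Federer1969].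
-/

noncomputable section

open scoped InnerProductSpace ENNReal NNReal Topology
open MeasureTheory Set Function Filter Module InnerProductSpace TopologicalSpace

namespace Literature.Geometry.GeometricMeasureTheory

-- Nested operator-norm instances on (duals of) `V [⋀^Fin m]→L[ℝ] ℝ`.
set_option maxSynthPendingDepth 2

/-! ### `⋀_m A` -/

section Push

variable {V : Type*} [NormedAddCommGroup V] [NormedSpace ℝ V]
  {V' : Type*} [NormedAddCommGroup V'] [NormedSpace ℝ V'] {m : ℕ}

/-- **The induced map `⋀_m A` on `m`-vectors**: `(push A w)(φ) = w (φ ∘ ⋀^m A)`.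
[cite: Federer1969, 1.3.1–1.3.2] -/
def Multivector.push (A : V →L[ℝ] V') : Multivector V m →L[ℝ] Multivector V' m :=
  ContinuousLinearMap.precomp ℝ (ContinuousAlternatingMap.compContinuousLinearMapCLM A :
    Covector V' m →L[ℝ] Covector V m)

/-- Unfolding `push`. [folklore] -/
@[simp] theorem Multivector.push_apply (A : V →L[ℝ] V') (w : Multivector V m) (φ : Covector V' m) :
    Multivector.push A w φ = w (φ.compContinuousLinearMap A) := rfl

/-- **`⋀_m A (v₁ ∧ ⋯ ∧ vₘ) = A v₁ ∧ ⋯ ∧ A vₘ`.** [cite: Federer1969, 1.3.2] -/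
theorem Multivector.push_frameVector (A : V →L[ℝ] V') (v : Fin m → V) :
    Multivector.push A (frameVector v) = frameVector fun i => A (v i) := by
  ext φ
  simp only [Multivector.push_apply, frameVector_apply,
    ContinuousAlternatingMap.compContinuousLinearMap_apply]
  rfl

/-- `push` is functorial: `⋀_m (B ∘ A) = ⋀_m B ∘ ⋀_m A`. [cite: Federer1969, 1.3.1] -/
theorem Multivector.push_comp {V'' : Type*} [NormedAddCommGroup V''] [NormedSpace ℝ V'']
    (B : V' →L[ℝ] V'') (A : V →L[ℝ] V') (w : Multivector V m) :
    Multivector.push (B.comp A) w = Multivector.push B (Multivector.push A w) := by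
  ext φ
  simp only [Multivector.push_apply]
  congr 1

/-- **Norm bound `‖⋀_m A w‖ ≤ ‖A‖ᵐ ‖w‖`.** [cite: Federer1969, 1.7.6] -/
theorem Multivector.norm_push_le (A : V →L[ℝ] V') (w : Multivector V m) :
    ‖Multivector.push A w‖ ≤ ‖A‖ ^ m * ‖w‖ := by
  refine ContinuousLinearMap.opNorm_le_bound _ (by positivity) fun φ => ?_
  rw [Multivector.push_apply]
  calc ‖w (φ.compContinuousLinearMap A)‖ ≤ ‖w‖ * ‖φ.compContinuousLinearMap A‖ := w.le_opNorm _
    _ ≤ ‖w‖ * (‖φ‖ * ‖A‖ ^ m) := by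
        gcongr
        have := φ.norm_compContinuousLinearMap_le A
        rwa [Fintype.card_fin] at this
    _ = ‖A‖ ^ m * ‖w‖ * ‖φ‖ := by ring

/-- `(A, w) ↦ ⋀_m A w` is continuous. [folklore] -/
theorem Multivector.continuous_push_uncurry :
    Continuous fun p : (V →L[ℝ] V') × Multivector V m => Multivector.push p.1 p.2 := by
  have h1 : Continuous fun p : (V →L[ℝ] V') × Multivector V m =>
      ((ContinuousAlternatingMap.compContinuousLinearMapCLM p.1 :
        Covector V' m →L[ℝ] Covector V m), p.2) :=
    (ContinuousAlternatingMap.continuous_compContinuousLinearMapCLM.comp continuous_fst).prodMk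
      continuous_snd
  have h2 : Continuous fun q : (Covector V' m →L[ℝ] Covector V m) × Multivector V m =>
      q.2.comp q.1 :=
    ((ContinuousLinearMap.compL ℝ (Covector V' m) (Covector V m) ℝ).continuous₂).comp
      (continuous_snd.prodMk continuous_fst)
  exact h2.comp h1

end Push

/-! ### Frames: sign against the Gram–Schmidt frame; degenerate frames -/

section Frames

variable {P : Type*} [NormedAddCommGroup P] [InnerProductSpace ℝ P] [FiniteDimensional ℝ P]
  {V : Type*} [NormedAddCommGroup V] [InnerProductSpace ℝ V] {m : ℕ}

/-- **An orthonormal frame of `im L` is `± J(L)⁻¹ (L e₁ ∧ ⋯ ∧ L eₘ)`**: if `ξ` is orthonormal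
with `span ξ = im L`, `L` injective, then `ξ₁ ∧ ⋯ ∧ ξₘ = σ J(L)⁻¹ • (L e₁ ∧ ⋯ ∧ L eₘ)` with
`σ = ±1`. [cite: Federer1969, 1.7.6, 3.2.19] -/
theorem frameVector_eq_sign_smul_of_span_eq_range {L : P →L[ℝ] V} (hL : Injective L)
    (e : OrthonormalBasis (Fin m) ℝ P) {ξ : Fin m → V} (hξ : Orthonormal ℝ ξ)
    (hspan : (Submodule.span ℝ (range ξ) : Set V) = range L) :
    ∃ σ : ℝ, (σ = 1 ∨ σ = -1) ∧
      frameVector ξ = (σ * ((L : P →ₗ[ℝ] V).normDet)⁻¹) • frameVector fun j => L (e j) := by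
  have hGS := orthonormal_gramSchmidtNormed_comp hL e
  have hspanGS : Submodule.span ℝ (range (gramSchmidtNormed ℝ fun j => L (e j))) =
      Submodule.span ℝ (range ξ) := by
    rw [span_gramSchmidtNormed_comp]
    apply SetLike.coe_injective
    rw [hspan, LinearMap.coe_range]
    rfl
  have hdet : (L : P →ₗ[ℝ] V).normDet ≠ 0 := by
    rw [Ne, LinearMap.normDet_eq_zero_iff_ker_ne_bot, not_not]
    exact LinearMap.ker_eq_bot.2 hL
  have hcomp := frameVector_comp_eq_normDet_smul_gramSchmidtNormed hL e
  have hGS' : frameVector (gramSchmidtNormed ℝ fun j => L (e j)) =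
      ((L : P →ₗ[ℝ] V).normDet)⁻¹ • frameVector fun j => L (e j) := by
    rw [hcomp, smul_smul, inv_mul_cancel₀ hdet, one_smul]
  rcases frameVector_eq_or_eq_neg_of_span_eq hGS hξ hspanGS.symm with h | h
  · refine ⟨1, Or.inl rfl, ?_⟩
    rw [h, hGS', one_mul]
  · refine ⟨-1, Or.inr rfl, ?_⟩
    rw [h, hGS', neg_one_mul]
    module

omit [FiniteDimensional ℝ P] in
/-- **Degenerate frames are killed by alternating forms**: `φ(L e₁, …, L eₘ) = 0` if `L` is not
injective. [folklore] -/
theorem apply_comp_eq_zero_of_not_injective {W : Type*} [NormedAddCommGroup W] [NormedSpace ℝ W]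
    {L : P →L[ℝ] W} (hL : ¬ Injective L) (e : OrthonormalBasis (Fin m) ℝ P) (φ : Covector W m) :
    φ (fun j => L (e j)) = 0 := by
  refine φ.toAlternatingMap.map_linearDependent _ fun hli => hL ?_
  -- `L` is injective: expand in the basis `e`
  intro x y hxy
  rw [← sub_eq_zero] at hxy ⊢
  rw [← map_sub] at hxy
  generalize x - y = x at hxy ⊢
  have hx : L x = 0 := hxy
  have hrepr := e.sum_repr x
  have hsum : ∑ i, e.repr x i • L (e i) = 0 := by
    have := congrArg L hrepr
    rw [_root_.map_sum] at this
    simp only [map_smul] at this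
    rw [this]
    exact hx
  have hcoef := Fintype.linearIndependent_iff.1 hli (fun i => e.repr x i) hsum
  rw [← hrepr]
  simp [hcoef]

omit [FiniteDimensional ℝ P] in
/-- **Frame vectors of degenerate images vanish**: `L e₁ ∧ ⋯ ∧ L eₘ = 0` if `L` is not injective.
[folklore] -/
theorem frameVector_comp_eq_zero_of_not_injective {W : Type*} [NormedAddCommGroup W] [NormedSpace ℝ W]
    {L : P →L[ℝ] W} (hL : ¬ Injective L) (e : OrthonormalBasis (Fin m) ℝ P) :
    frameVector (fun j => L (e j)) = 0 := by
  ext φ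
  simp [frameVector_apply, apply_comp_eq_zero_of_not_injective hL e φ]

end Frames

end Literature.Geometry.GeometricMeasureTheory
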